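import Summits.NavierStokesRegularity.NavierStokesRegularity.Theses.AxisymmetricExtremality
import Summits.NavierStokesRegularity.NavierStokesRegularity.Theorems.AxisymmetricExtremalityMinimalDatumPFoldThresholdFinite
import Summits.NavierStokesRegularity.NavierStokesRegularity.Theorems.AxisymmetricExtremalityMinimalDatumPFoldNotAeZero
import Summits.NavierStokesRegularity.NavierStokesRegularity.Theorems.AxisymmetricExtremalityMinimalDatumPFoldScaleRigidity
import Summits.NavierStokesRegularity.NavierStokesRegularity.Theorems.AxisymmetricExtremalityMinimalDatumPFoldShiftRigidity
import Summits.NavierStokesRegularity.NavierStokesRegularity.Theorems.AxisymmetricExtremalityMinimalDatumPFoldRecentre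
import Summits.NavierStokesRegularity.NavierStokesRegularity.Theorems.AxisymmetricExtremalityMinimalDatumPFoldAeToExact

/-!
# Route AxisymmetricExtremality — crux `MinimalDatumPFold` (stmt-NavierStokesRegularity-15452) reduced to the Smith step

`MinimalDatumPFold` (Clay failure at viscosity `ν` ⇒ for unboundedly many `p ≥ 2` an exactly
`R_{2π/p}`-equivariant Rusin–Šverák minimal blow-up datum) follows from ONE statement, the
fixed-point output of P. A. Smith theory on the moduli space `M̂(ν) = M(ν)/Sim` written at the
level of data (`ρ_max^pure(ν) < ⊤ ⇒ ∀ N ∃ p ≥ max(N,2) ∃ (u₀,g) ∈ M(ν) ∃ λ > 0, x₀` with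
`λ u₀(λ R x − x₀) = R (u₀ x)` a.e., `R = R_{2π/p}` about the `x₂`-axis) — the registered stub
`stub_smithFixedModSim` of the crux line `Cruxes/MinimalDatumPFold/Lines/birth.lean`, which carries
the whole open content of the crux (it needs `F_p`-acyclicity of `M̂(ν)`, AlldayPuppe1993 Cor. 1.4.7;
no source supplies it). Everything else is PROVED in the tree and composed here:
the front end `stub_thresholdFinite_of_clayFailure` (Clay failure ⇒ `ρ_max^pure(ν) < ⊤`, via
Kato→Clay and the Schwartz ⇒ `Ḣ^{1/2}` embedding), and the lift `stub_minimalDatum_not_aeZero`,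
`stub_liftScaleRigidity` (`λ = 1`), `stub_liftShiftRigidity` (`(x₀)₂ = 0`), `stub_liftRecentre`
(a.e.-equivariant minimal datum after recentring the axis), `stub_liftAeToExact` (exact equivariance
by modification on an `R`-invariant null set). Pure logic otherwise (`rescaleData 1 = id` by `one_smul`).

## References
* W. Rusin, V. Šverák, J. Funct. Anal. 260 (2011) 879–891; arXiv:0911.0500, Cor. 4.3, §1 p. 3.
* C. Allday, V. Puppe, *Cohomological methods in transformation groups*, CUP 1993, Cor. 1.4.7, Thm. 3.1.10.
-/

set_option linter.dupNamespace false

namespace Summit.NavierStokesRegularity.NavierStokesRegularity.Theorems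

/-- **The crux `MinimalDatumPFold` modulo the Smith fixed point.** If for every `ν > 0` with
`ρ_max^pure(ν) < ⊤` and every `N` there are `p ≥ max(N, 2)` and a Rusin–Šverák minimal blow-up
datum `(u₀, g)` fixed MODULO Sim by the rotation `R_{2π/p}` about the `x₂`-axis
(`λ u₀(λ R x − x₀) = R (u₀ x)` for a.e. `x`, some `λ > 0`, `x₀ ∈ ℝ³`), then
`AxisymmetricExtremality.MinimalDatumPFold` holds: given a Clay failure at `ν`, the front end gives
`ρ_max^pure(ν) < ⊤` (`stub_thresholdFinite_of_clayFailure`); the datum from the hypothesis is not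
a.e. zero (`stub_minimalDatum_not_aeZero`), so scale rigidity forces `λ = 1`
(`stub_liftScaleRigidity`), shift rigidity forces `(x₀)₂ = 0` (`stub_liftShiftRigidity`),
recentring the axis gives an a.e. `R`-equivariant minimal blow-up datum (`stub_liftRecentre`) and
modification on an invariant null set an exactly equivariant one (`stub_liftAeToExact`).
[cite: RusinSverak2011, Cor. 4.3 and §1 p. 3 (arXiv:0911.0500)] -/
theorem minimalDatumPFold_of_smithFixedModSim :
    (∀ ν : ℝ, 0 < ν → Literature.Analysis.FluidPDE.rusinSverakRhoMaxPure ν < ⊤ → ∀ N : ℕ, ∃ p : ℕ, N ≤ p ∧ 2 ≤ p ∧ ∃ (u₀ : EuclideanSpace ℝ (Fin 3) → EuclideanSpace ℝ (Fin 3)) (g : Literature.Analysis.FunctionSpaces.HomSobolev (EuclideanSpace ℝ (Fin 3)) (EuclideanSpace ℂ (Fin 3)) (1 / 2 : ℝ)), Literature.Analysis.FluidPDE.IsMinimalBlowupDatum ν u₀ g ∧ ∃ (lam : ℝ) (x₀ : EuclideanSpace ℝ (Fin 3)), 0 < lam ∧ ∀ᵐ x ∂(MeasureTheory.volume : MeasureTheory.Measure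 (EuclideanSpace ℝ (Fin 3))), Literature.Analysis.FluidPDE.rescaleData lam (fun y => u₀ (y - x₀)) (WithLp.toLp 2 ![Real.cos (2 * Real.pi / p) * x 0 - Real.sin (2 * Real.pi / p) * x 1, Real.sin (2 * Real.pi / p) * x 0 + Real.cos (2 * Real.pi / p) * x 1, x 2]) = WithLp.toLp 2 ![Real.cos (2 * Real.pi / p) * u₀ x 0 - Real.sin (2 * Real.pi / p) * u₀ x 1, Real.sin (2 * Real.pi / p) * u₀ x 0 + Real.cos (2 * Real.pi / p) * u₀ x 1, u₀ x 2]) → Summit.NavierStokesRegularity.NavierStokesRegularity.Theses.AxisymmetricExtremality.MinimalDatumPFold := by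
  intro hSmith ν hν hclay N
  obtain ⟨p, hNp, h2p, u₀, g, hmin, lam, x₀, hlam, hfix⟩ :=
    hSmith ν hν (stub_thresholdFinite_of_clayFailure ν hν hclay) N
  have hne : ¬ (u₀ =ᵐ[(MeasureTheory.volume : MeasureTheory.Measure (EuclideanSpace ℝ (Fin 3)))]
      (0 : EuclideanSpace ℝ (Fin 3) → EuclideanSpace ℝ (Fin 3))) := stub_minimalDatum_not_aeZero ν u₀ g hmin
  have hL3 : MeasureTheory.MemLp u₀ 3 (MeasureTheory.volume : MeasureTheory.Measure (EuclideanSpace ℝ (Fin 3))) := by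
    obtain ⟨h3, -, -, -, -⟩ := hmin
    exact h3
  obtain rfl : lam = 1 := stub_liftScaleRigidity p u₀ hL3 hne lam x₀ hlam hfix
  have hfix' : ∀ᵐ x ∂(MeasureTheory.volume : MeasureTheory.Measure (EuclideanSpace ℝ (Fin 3))),
      u₀ (WithLp.toLp 2 ![Real.cos (2 * Real.pi / p) * x 0 - Real.sin (2 * Real.pi / p) * x 1, Real.sin (2 * Real.pi / p) * x 0 + Real.cos (2 * Real.pi / p) * x 1, x 2] - x₀) =
        WithLp.toLp 2 ![Real.cos (2 * Real.pi / p) * u₀ x 0 - Real.sin (2 * Real.pi / p) * u₀ x 1, Real.sin (2 * Real.pi / p) * u₀ x 0 + Real.cos (2 * Real.pi / p) * u₀ x 1, u₀ x 2] := by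
    filter_upwards [hfix] with x hx
    simpa only [Literature.Analysis.FluidPDE.rescaleData, one_smul] using hx
  have hx₀ : x₀ 2 = 0 := stub_liftShiftRigidity p u₀ hL3 hne x₀ hfix'
  obtain ⟨u₁, g₁, hmin₁, hfix₁⟩ := stub_liftRecentre ν p h2p u₀ g hmin x₀ hx₀ hfix'
  obtain ⟨u₂, g₂, hmin₂, hsym⟩ := stub_liftAeToExact ν p h2p u₁ g₁ hmin₁ hfix₁
  exact ⟨p, hNp, h2p, u₂, g₂, hmin₂, hsym⟩

end Summit.NavierStokesRegularity.NavierStokesRegularity.Theorems
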